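import Summits.Ventures.PercRepro.S1EightSixFourPointLine

/-!
# PercRepro — THE SHAPE `(rank 5 on 7) ⊕ (rank 3 on 7)` OF THE `(8, 6)` CELL (p2, gen 28; SUBCLAIM-S1 §6.10
(xvii)(p); PARTIAL — towards the `(8, 6)` capstone)

`M` coloop-free of rank `5` on `7` points (corank `2`), `N` coloop-free of rank `3` on `7` points (corank `4`), all
pairs of rank `2`. `#U = N_M(5, 1) N_N(3, 3) + N_M(5, 2) N_N(3, 2) ≤ 7 (70 − t) + 52 N_M(5, 2)` (`N_N(3, 2) ≤ 21 + t +
q₄ ≤ 52` by the incidence counts, `N_N(3, 3) ≤ 70 − t`), Theorem N at `(5, 2)` on `M`; `#Y ≥ f_M(2) f_N(3) + f_M(3)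
(f_N(2) + f_N(3)) + f_M(4) (f_N(1) + f_N(2) + f_N(3)) + f_M(5) (f_N(0) + f_N(1) + f_N(2))` with `f_N(2) + f_N(3) = 120`,
`f_N(3) ≥ 99 − t − q₄ − q₅ ≥ 66`, `f_M(3) ≥ 28`, `f_M(4) ≥ 14`, `f_M(5) ≥ 8`:
`Φ(8, 4) · #U ≤ 2483 − 35.5 t + 79 (f_M(3) + f_M(4)) ≤ 1618 + 120 f_M(3) + 127 f_M(4) ≤ #Y`.
Nothing is claimed about any cell.

* `c025_eight_four_disjointSum_five_seven_three_seven`.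
Axioms: standard.
-/

open scoped Matroid

namespace PercRepro

namespace S1

open Set

variable {α : Type}

/-- The arithmetic of `(rank 5 on 7) ⊕ (rank 3 on 7)` at `(8, 4)`. -/
theorem consumer_arith_five_seven_three_seven {u y P t G2 G3 F3 F4 : ℚ} (hU : u ≤ 7 * (70 - t) + 52 * P)
    (h52 : 10 / 3 * P ≤ F3 + F4) (hY : 21 * G3 + 120 * F3 + 127 * F4 + 8 * (1 + 7 + G2) ≤ y) (hG3 : 66 ≤ G3)
    (hG2 : 21 ≤ G2) (hF3 : 28 ≤ F3) (hF4 : 14 ≤ F4) (ht : 0 ≤ t) : 76 / 15 * u ≤ y := by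
  linarith

/-- **`M ⊕ N` at `(8, 4)`**: `M` coloop-free of rank `5` on `7` points and `N` coloop-free of rank `3` on `7` points,
both with all pairs of rank `2`. -/
theorem c025_eight_four_disjointSum_five_seven_three_seven (M N : Matroid α) [M.Finite] [N.Finite]
    (h : Disjoint M.E N.E) (hM : M.eRank = ((5 : ℕ) : ℕ∞)) (hME : M.E.ncard = 7) (hcolM : M.coloops = ∅)
    (hpairsM : ∀ e ∈ M.E, ∀ f ∈ M.E, e ≠ f → M.eRk {e, f} = 2) (hN : N.eRank = ((3 : ℕ) : ℕ∞))
    (hNE : N.E.ncard = 7) (hcolN : N.coloops = ∅) (hpairsN : ∀ e ∈ N.E, ∀ f ∈ N.E, e ≠ f → N.eRk {e, f} = 2) :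
    phiK 8 4 * ({A : Set α | A ⊆ (M.disjointSum N h).E ∧ (M.disjointSum N h).eRk A = ((8 : ℕ) : ℕ∞) ∧
        (M.disjointSum N h).eRk ((M.disjointSum N h).E \ A) = ((4 : ℕ) : ℕ∞)}.ncard : ℚ) ≤
      ({A : Set α | A ⊆ (M.disjointSum N h).E ∧ ((4 : ℕ) : ℕ∞) < (M.disjointSum N h).eRk A ∧
        (M.disjointSum N h).eRk A < ((8 : ℕ) : ℕ∞)}.ncard : ℚ) := by
  -- the rank-`2` sets of `N`
  have hcl : ∀ x ∈ N.E, ∀ y ∈ N.E, x ≠ y → (N.closure {x, y}).ncard ≤ 3 + 2 := by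
    intro x hx y hy hxy
    have := ncard_closure_pair_le_of_coloops' N hN (by norm_num) hcolN hpairsN hx hy hxy
    rw [hNE] at this
    omega
  have ht := choose_mul_ncard_rankTwoSets_le N hpairsN (c := 3) (m := 3) hcl
  have hq4 := choose_mul_ncard_rankTwoSets_le N hpairsN (c := 3) (m := 4) hcl
  have hq5 := choose_mul_ncard_rankTwoSets_le N hpairsN (c := 3) (m := 5) hcl
  rw [hNE, show Nat.choose 3 2 = 3 by decide, show Nat.choose 3 (3 - 2) = 3 by decide,
    show Nat.choose 7 2 = 21 by decide] at ht
  rw [hNE, show Nat.choose 4 2 = 6 by decide, show Nat.choose 3 (4 - 2) = 3 by decide,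
    show Nat.choose 7 2 = 21 by decide] at hq4
  rw [hNE, show Nat.choose 5 2 = 10 by decide, show Nat.choose 3 (5 - 2) = 1 by decide,
    show Nat.choose 7 2 = 21 by decide] at hq5
  have h32 := ncard_profileSet_three_two_le_rank_three_seven (M := N) hNE
  have h33 := ncard_profileSet_three_three_le_rank_three_seven (M := N) hNE
  have h32' : (profileSet N 3 2).ncard ≤ 52 := by omega
  -- the `U`-side: the slices `(5, 1)` and `(5, 2)`
  have hU : {A : Set α | A ⊆ (M.disjointSum N h).E ∧ (M.disjointSum N h).eRk A = ((8 : ℕ) : ℕ∞) ∧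
      (M.disjointSum N h).eRk ((M.disjointSum N h).E \ A) = ((4 : ℕ) : ℕ∞)}.ncard ≤
      7 * (70 - (rankTwoSets N 3).ncard) + 52 * (profileSet M 5 2).ncard := by
    rw [disjointSum_ncard_U_eq_finsum M N h 8 4, finsum_mem_coe_finset]
    rw [Finset.sum_eq_add_of_mem (5, 1) (5, 2) (by decide) (by decide) (by decide) ?_]
    · dsimp only
      show (profileSet M 5 1).ncard * (profileSet N 3 3).ncard + (profileSet M 5 2).ncard * (profileSet N 3 2).ncard ≤ _
      have h51 := ncard_profileSet_top_one_le_of_pairs' hpairsM 5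
      rw [hME] at h51
      have e1 := Nat.mul_le_mul h51 (show (profileSet N 3 3).ncard ≤ 70 - (rankTwoSets N 3).ncard by omega)
      have e2 := Nat.mul_le_mul_left (profileSet M 5 2).ncard h32'
      omega
    · rintro ⟨a, b⟩ hmem ⟨hne1, hne2⟩
      rw [Finset.mem_product, Finset.mem_range, Finset.mem_range] at hmem
      dsimp only
      rcases Nat.lt_or_ge 5 a with ha | ha
      · rw [profileSet_eq_empty_of_eRank_lt M hM ha b, ncard_empty, zero_mul]
      rcases Nat.lt_or_ge a 5 with ha' | ha'
      · have h8a : 3 < 8 - a := by omega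
        rw [profileSet_eq_empty_of_eRank_lt N hN h8a (4 - b), ncard_empty, mul_zero]
      have ha5 : a = 5 := by omega
      subst ha5
      rw [show (8 : ℕ) - 5 = 3 from rfl]
      rcases Nat.lt_or_ge b 1 with hb | hb
      · have hb0 : b = 0 := by omega
        subst hb0
        rw [profileSet_eq_empty_of_eRank_lt_snd N hN (by norm_num) 3, ncard_empty, mul_zero]
      · have hb3 : 2 < b := by
          rcases Nat.lt_or_ge b 3 with hb3 | hb3
          · exfalso
            rcases Nat.lt_or_ge b 2 with hb2 | hb2
            · exact hne1 (by congr 1; omega)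
            · exact hne2 (by congr 1; omega)
          · omega
        -- `N_M(5, b) = ∅` for `b ≥ 3` on `7` points
        have h7 : M.E.ncard < 5 + b := by rw [hME]; omega
        rw [profileSet_eq_empty_of_ncard_lt M h7, ncard_empty, zero_mul]
  -- the `Y`-side
  have hY : 21 * (rankSet N 3).ncard + 120 * (rankSet M 3).ncard + 127 * (rankSet M 4).ncard +
      8 * (1 + 7 + (rankSet N 2).ncard) ≤
      {A : Set α | A ⊆ (M.disjointSum N h).E ∧ ((4 : ℕ) : ℕ∞) < (M.disjointSum N h).eRk A ∧
        (M.disjointSum N h).eRk A < ((8 : ℕ) : ℕ∞)}.ncard := by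
    rw [disjointSum_ncard_Y_eq_finsum M N h 8 4, finsum_mem_coe_finset]
    have hsub : ({(2, 3), (3, 2), (3, 3), (4, 1), (4, 2), (4, 3), (5, 0), (5, 1), (5, 2)} : Finset (ℕ × ℕ)) ⊆
        (Finset.range 8 ×ˢ Finset.range 8).filter (fun x : ℕ × ℕ => 4 < x.1 + x.2 ∧ x.1 + x.2 < 8) := by
      decide
    refine le_trans ?_ (Finset.sum_le_sum_of_subset hsub)
    rw [Finset.sum_insert (by decide), Finset.sum_insert (by decide), Finset.sum_insert (by decide),
      Finset.sum_insert (by decide), Finset.sum_insert (by decide), Finset.sum_insert (by decide),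
      Finset.sum_insert (by decide), Finset.sum_insert (by decide), Finset.sum_singleton]
    dsimp only
    have F2 : 21 ≤ (rankSet M 2).ncard := by
      have := choose_le_ncard_rankSet_two_of_pairs hpairsM
      rwa [hME, show Nat.choose 7 2 = 21 by decide] at this
    have F5 : 8 ≤ (rankSet M 5).ncard := by
      have := succ_le_ncard_rankSet_top_of_coloops M hM hcolM
      rwa [hME] at this
    have G0 : 1 ≤ (rankSet N 0).ncard := by
      have h0 : (∅ : Set α) ∈ rankSet N 0 := ⟨empty_subset _, by rw [N.eRk_empty]; rfl⟩
      exact (ncard_pos (rankSet_finite N 0)).mpr ⟨∅, h0⟩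
    have G1 : 7 ≤ (rankSet N 1).ncard := by
      have := ncard_le_ncard_rankSet_one_of_pairs hpairsN (by omega)
      rwa [hNE] at this
    have G23 := ncard_rankSet_two_add_three_ge_of_pairs hN hpairsN
    rw [hNE, show 2 ^ 7 - 1 - 7 = 120 by decide] at G23
    have e23 := Nat.mul_le_mul_right (rankSet N 3).ncard F2
    have e3 : (rankSet M 3).ncard * 120 ≤ (rankSet M 3).ncard * (rankSet N 2).ncard +
        (rankSet M 3).ncard * (rankSet N 3).ncard := by
      rw [← mul_add]; exact Nat.mul_le_mul_left _ G23
    have e4 : (rankSet M 4).ncard * 127 ≤ (rankSet M 4).ncard * (rankSet N 1).ncard +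
        (rankSet M 4).ncard * (rankSet N 2).ncard + (rankSet M 4).ncard * (rankSet N 3).ncard := by
      rw [← mul_add, ← mul_add]; exact Nat.mul_le_mul_left _ (by omega)
    have e50 := Nat.mul_le_mul F5 G0
    have e51 := Nat.mul_le_mul F5 G1
    have e52 := Nat.mul_le_mul_right (rankSet N 2).ncard F5
    nlinarith [e23, e3, e4, e50, e51, e52]
  -- the profiles
  have hG23 := ncard_rankSet_two_add_three_ge_of_pairs hN hpairsN
  rw [hNE, show 2 ^ 7 - 1 - 7 = 120 by decide] at hG23
  have hG2hi := ncard_rankSet_two_le_rank_three_seven hN hNE hcolN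
  have hG3 : 66 ≤ (rankSet N 3).ncard := by omega
  have hG2 : 21 ≤ (rankSet N 2).ncard := by
    have := choose_le_ncard_rankSet_two_of_pairs hpairsN
    rwa [hNE, show Nat.choose 7 2 = 21 by decide] at this
  have hF3 := ncard_rankSet_three_ge_rank_five_seven M hM hME hcolM hpairsM
  have hF4 := ncard_rankSet_four_ge_rank_five_seven M hM hME hcolM hpairsM
  have h52 : (10 / 3 : ℚ) * ((profileSet M 5 2).ncard : ℚ) ≤
      ((rankSet M 3).ncard : ℚ) + ((rankSet M 4).ncard : ℚ) := by
    have h0 := ThmN.c025_two_all M 5 (by norm_num)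
    unfold ThmN.RLS at h0
    rw [phiK_five_two, ySet_eq_rankSet_union_of_eq M (q := 2) (p := 5) (k := 3) (k' := 4) rfl rfl rfl,
      ncard_union_eq (rankSet_disjoint_of_ne M (by norm_num)) (rankSet_finite M 3) (rankSet_finite M 4)] at h0
    push_cast at h0
    exact h0
  rw [phiK_eight_four]
  have ht70 : (rankTwoSets N 3).ncard ≤ 70 := by omega
  have hU' : (({A : Set α | A ⊆ (M.disjointSum N h).E ∧ (M.disjointSum N h).eRk A = ((8 : ℕ) : ℕ∞) ∧
      (M.disjointSum N h).eRk ((M.disjointSum N h).E \ A) = ((4 : ℕ) : ℕ∞)}.ncard : ℕ) : ℚ) ≤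
      7 * (70 - ((rankTwoSets N 3).ncard : ℚ)) + 52 * ((profileSet M 5 2).ncard : ℚ) := by
    have hcast : ((7 * (70 - (rankTwoSets N 3).ncard) + 52 * (profileSet M 5 2).ncard : ℕ) : ℚ) =
        7 * (70 - ((rankTwoSets N 3).ncard : ℚ)) + 52 * ((profileSet M 5 2).ncard : ℚ) := by
      push_cast [Nat.cast_sub ht70]
      ring
    rw [← hcast]
    exact_mod_cast hU
  have hY' : 21 * ((rankSet N 3).ncard : ℚ) + 120 * ((rankSet M 3).ncard : ℚ) + 127 * ((rankSet M 4).ncard : ℚ) +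
      8 * (1 + 7 + ((rankSet N 2).ncard : ℚ)) ≤
      (({A : Set α | A ⊆ (M.disjointSum N h).E ∧ ((4 : ℕ) : ℕ∞) < (M.disjointSum N h).eRk A ∧
        (M.disjointSum N h).eRk A < ((8 : ℕ) : ℕ∞)}.ncard : ℕ) : ℚ) := by
    exact_mod_cast hY
  exact consumer_arith_five_seven_three_seven hU' h52 hY' (by exact_mod_cast hG3) (by exact_mod_cast hG2)
    (by exact_mod_cast hF3) (by exact_mod_cast hF4) (Nat.cast_nonneg _)

end S1

end PercRepro
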